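import Mathlib.Algebra.BigOperators.Ring.Finset
import Mathlib.Algebra.BigOperators.Group.Finset.Sigma
import Mathlib.Data.Finset.Powerset
import Mathlib.Logic.Function.Iterate
import Mathlib.Tactic.Ring
import Summits.KontsevichZagierPeriods.KontsevichZagierPeriods.Theorems.ValuedFieldSpecialisationCTConstructionAltSumChoosePow
import HarnessLib

/-!
# Route ValuedFieldSpecialisation — crux `CTConstruction`: closed form of the iterated coefficient operator

Helper toward crux stmt-KontsevichZagierPeriods-3495 (`CTConstruction`), line `registered`, stub
`stub_thetaIter_closedForm` of the lead's "dilation elimination". Pure combinatorics over `ℤ`.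

On coefficient vectors `f : Finset (Fin B) → ℤ` the dilation acts by the operator
`Θ̂ f T = a * Σ_{S ⊆ T} f S`. We prove:

1. the closed form of its iterates, `(Θ̂^[n] c) T = a ^ n * Σ_{S ⊆ T} n ^ |T \ S| * c S`
   (induction on `n`; the step is the convolution identity
   `Σ_{S ⊆ S' ⊆ T} n ^ |S' \ S| = Σ_{U ⊆ T \ S} n ^ |U| = (n + 1) ^ |T \ S|`, i.e. the binomial
   theorem `Finset.sum_pow_mul_eq_add_pow` after the reindexing `U = S' \ S`);
2. the alternating evaluation: if `c` is supported on co-cardinality `≤ n` inside `T`, then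
   `Σ_{i=0}^{n} (-1)^(n-i) C(n,i) Σ_{S ⊆ T} i ^ |T \ S| c S = n! * Σ_{S ⊆ T, |T \ S| = n} c S`,
   by swapping the sums and the landed evaluation `stub_altSum_choose_mul_pow`
   (`Σ_i (-1)^(n-i) C(n,i) i^k = [k = n] n!` for `k ≤ n`).

Sources: folklore (chain counting in the Boolean lattice / calculus of finite differences).
No new definitions.
-/

namespace Summit.KontsevichZagierPeriods.ValuedFieldSpecialisation

open Finset

/-- Reindexing the interval `{S' ⊆ T | S ⊆ S'}` by `U = S' \ S ∈ (T \ S).powerset`, followed by the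
binomial theorem: for `S ⊆ T`, `Σ_{S ⊆ S' ⊆ T} n ^ |S' \ S| = (n + 1) ^ |T \ S|`. [folklore] -/
theorem sum_filter_powerset_pow_card_sdiff {B : ℕ} (n : ℤ) {S T : Finset (Fin B)} (hST : S ⊆ T) :
    ∑ S' ∈ T.powerset.filter (fun S' => S ⊆ S'), n ^ (S' \ S).card = (n + 1) ^ (T \ S).card := by
  rw [← Finset.sum_pow_mul_eq_add_pow n 1 (T \ S)]
  simp only [one_pow, mul_one]
  refine Finset.sum_nbij' (fun S' => S' \ S) (fun U => S ∪ U) ?_ ?_ ?_ ?_ ?_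
  · intro S' hS'
    simp only [Finset.mem_filter, Finset.mem_powerset] at hS'
    exact Finset.mem_powerset.mpr (Finset.sdiff_subset_sdiff hS'.1 le_rfl)
  · intro U hU
    rw [Finset.mem_powerset] at hU
    simp only [Finset.mem_filter, Finset.mem_powerset]
    exact ⟨Finset.union_subset hST (hU.trans Finset.sdiff_subset), Finset.subset_union_left⟩
  · intro S' hS'
    simp only [Finset.mem_filter, Finset.mem_powerset] at hS'
    exact Finset.union_sdiff_of_subset hS'.2
  · intro U hU
    rw [Finset.mem_powerset] at hU
    show (S ∪ U) \ S = U
    rw [Finset.union_sdiff_left]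
    exact Finset.sdiff_eq_self_of_disjoint (Finset.disjoint_of_subset_left hU Finset.sdiff_disjoint)
  · intro S' _
    rfl

/-- **Closed form of the iterated coefficient operator.** With `Θ̂ f T = a * Σ_{S ⊆ T} f S`,
`(Θ̂^[n] c) T = a ^ n * Σ_{S ⊆ T} n ^ |T \ S| * c S`: the coefficient of `c S` counts the chains
`S = S₀ ⊆ S₁ ⊆ ⋯ ⊆ Sₙ = T`, and each element of `T \ S` chooses the step at which it enters.
Induction on `n`, the step being `sum_filter_powerset_pow_card_sdiff`. [folklore] -/
theorem thetaIter_apply {B : ℕ} (a : ℤ) (c : Finset (Fin B) → ℤ) (n : ℕ) (T : Finset (Fin B)) :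
    ((fun f : Finset (Fin B) → ℤ => fun T : Finset (Fin B) => a * ∑ S ∈ T.powerset, f S)^[n] c) T =
      a ^ n * ∑ S ∈ T.powerset, (n : ℤ) ^ (T \ S).card * c S := by
  induction n generalizing T with
  | zero =>
    simp only [Function.iterate_zero, id_eq, pow_zero, one_mul, Nat.cast_zero]
    rw [Finset.sum_eq_single_of_mem T (Finset.mem_powerset.mpr le_rfl)]
    · simp
    · intro S hS hST
      rw [Finset.mem_powerset] at hS
      have hcard : (T \ S).card ≠ 0 := by
        rw [Ne, Finset.card_eq_zero, Finset.sdiff_eq_empty_iff_subset]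
        exact fun h => hST (le_antisymm hS h)
      rw [zero_pow hcard, zero_mul]
  | succ n ih =>
    rw [Function.iterate_succ_apply']
    simp only [ih]
    rw [← Finset.mul_sum, ← mul_assoc, ← pow_succ', Nat.cast_succ]
    congr 1
    rw [Finset.sum_comm' (t' := T.powerset) (s' := fun S => T.powerset.filter (fun S' => S ⊆ S')) ?_]
    · refine Finset.sum_congr rfl fun S hS => ?_
      rw [Finset.mem_powerset] at hS
      rw [← Finset.sum_mul, sum_filter_powerset_pow_card_sdiff (n : ℤ) hS]
    · intro S' S
      simp only [Finset.mem_powerset, Finset.mem_filter]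
      constructor
      · rintro ⟨h1, h2⟩
        exact ⟨⟨h1, h2⟩, h2.trans h1⟩
      · rintro ⟨⟨h1, h2⟩, _⟩
        exact ⟨h1, h2⟩

/-- **Alternating evaluation.** If `c S ≠ 0` only for `S ⊆ T` with `|T \ S| ≤ n`, then
`Σ_{i=0}^{n} (-1)^(n-i) C(n,i) Σ_{S ⊆ T} i ^ |T \ S| c S = n! * Σ_{S ⊆ T, |T \ S| = n} c S`:
swap the two sums and evaluate `Σ_i (-1)^(n-i) C(n,i) i ^ |T \ S|` by
`stub_altSum_choose_mul_pow` (the terms with `c S = 0` vanish on both sides). [folklore] -/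
theorem altSum_thetaIter_eval {B : ℕ} (n : ℕ) (c : Finset (Fin B) → ℤ) (T : Finset (Fin B))
    (hc : ∀ S, S ⊆ T → c S ≠ 0 → (T \ S).card ≤ n) :
    (∑ i ∈ Finset.range (n + 1), (-1 : ℤ) ^ (n - i) * (n.choose i : ℤ) *
        ∑ S ∈ T.powerset, (i : ℤ) ^ (T \ S).card * c S) =
      (n.factorial : ℤ) * ∑ S ∈ T.powerset.filter (fun S => (T \ S).card = n), c S := by
  simp_rw [Finset.mul_sum]
  rw [Finset.sum_comm, Finset.sum_filter]
  refine Finset.sum_congr rfl fun S hS => ?_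
  rw [Finset.mem_powerset] at hS
  by_cases hcS : c S = 0
  · simp [hcS]
  · have h := stub_altSum_choose_mul_pow n (T \ S).card (hc S hS hcS)
    simp_rw [← mul_assoc]
    rw [← Finset.sum_mul, h, ite_mul, zero_mul]

/-- **Closed form of the iterated coefficient operator and its alternating evaluation**
(stub `stub_thetaIter_closedForm` of crux `CTConstruction`, line `registered`). For every `B`:
(1) with `Θ̂ f T = a * Σ_{S ⊆ T} f S` on `f : Finset (Fin B) → ℤ`,
`(Θ̂^[n] c) T = a ^ n * Σ_{S ⊆ T} n ^ |T \ S| * c S` (`thetaIter_apply`); (2) if `c S ≠ 0` only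
for `S ⊆ T` with `|T \ S| ≤ n`, then
`Σ_{i=0}^{n} (-1)^(n-i) C(n,i) Σ_{S ⊆ T} i ^ |T \ S| c S = n! * Σ_{S ⊆ T, |T \ S| = n} c S`
(`altSum_thetaIter_eval`, from the landed `stub_altSum_choose_mul_pow`). [folklore] -/
theorem stub_thetaIter_closedForm : ∀ (B : ℕ), (∀ (a : ℤ) (c : Finset (Fin B) → ℤ) (n : ℕ) (T : Finset (Fin B)), ((fun f : Finset (Fin B) → ℤ => fun T : Finset (Fin B) => a * ∑ S ∈ T.powerset, f S)^[n] c) T = a ^ n * ∑ S ∈ T.powerset, (n : ℤ) ^ (T \ S).card * c S) ∧ (∀ (n : ℕ) (c : Finset (Fin B) → ℤ) (T : Finset (Fin B)), (∀ S, S ⊆ T → c S ≠ 0 → (T \ S).card ≤ n) → (∑ i ∈ Finset.range (n + 1), (-1 : ℤ) ^ (n - i) * (n.choose i : ℤ) * ∑ S ∈ T.powerset, (i : ℤ) ^ (T \ S).card * c S) = (n.factorial : ℤ) * ∑ S ∈ T.powerset.filter (fun S => (T \ S).card = n), c S) :=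
  fun _ => ⟨fun a c n T => thetaIter_apply a c n T, fun n c T hc => altSum_thetaIter_eval n c T hc⟩

end Summit.KontsevichZagierPeriods.ValuedFieldSpecialisation
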